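import Mathlib
import HarnessLib

/-!
# Re-coupling through conditional laws (stub S4 of line `pinch-resampling`, brick B2: the coupling-improvement shell)

Crux `Summit.CriticalPhenomena.CardyFormulaZ2.Theses.CardyMagicRigidity.NestingRigidity`
(stmt-CriticalPhenomena-4835), line `pinch-resampling` v2, registered stub `stub_tomographicTransfer`
(`FourArmCouplingT → FourArmCouplingZ2 → LoopLimitZ2Blind → LoopLimitZ2EqT`).  Part (iv) of its mechanism replaces a
coupling `P` of the two critical percolation measures `μ` (bond-`ℤ²`) and `μ'` (site-`𝕋`), good for the BLIND data, by
a coupling good for `d_CN`, by re-drawing on both sides the routing data from their own conditional laws given the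
retained data `Y`, `Y'` and coupling the two re-draws.  The abstract probability behind this is the following
LAW-PRESERVATION BY DISINTEGRATION, which needs no stopping-set / strong-Markov structure and no assumption on how the
retained statistic `Y` is selected (any measurable `Y` will do):

* `comp_prodMkRight_eq_comp_map_fst`, `comp_prodMkLeft_eq_comp_map_snd` — bookkeeping: composing a measure on
  `S × S'` with a kernel that only reads the first (second) coordinate is composing its first (second) marginal;
* `condDistrib_id_comp_map` — the disintegration identity `(Law(ω | Y)) ∘ Law(Y) = Law(ω)` (Mathlib's
  `condDistrib_comp_map` at `id`);
* **`map_fst_comp_eq_and_map_snd_comp_eq_of_condDistrib`** (registered anchor) — if `P` couples `μ` and `μ'`,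
  `Y : Ω → S`, `Y' : Ω' → S'` are measurable, and `κ` is a kernel on `S × S'` whose value at `(y, y')` couples, for
  `Law_P(Y, Y')`-a.e. `(y, y')`, the conditional law `μ(· | Y = y)` with the conditional law `μ'(· | Y' = y')`
  (`ProbabilityTheory.condDistrib id Y μ y`, resp. `condDistrib id Y' μ' y'`), then the glued measure
  `κ ∘ₘ Law_P(Y, Y')` is again a coupling of `μ` and `μ'`;
* `comp_apply_eq_lintegral`, `comp_apply_le_lintegral_of_ae_le` — the bad event of the glued coupling is the
  `Law_P(Y, Y')`-average of the bad events of the fibre couplings (so a fibrewise total-variation bound integrates).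

In the transfer, `Y` = (selected neck regions, configuration off them) on each lattice, the fibre coupling `κ (y, y')`
draws the two routings with one shared uniform variable, and its mismatch is the total-variation distance of the two
routing laws (`…RoutingOdds`).  Pure measure theory; no percolation object is mentioned.
-/

noncomputable section

namespace Summit.CriticalPhenomena.CardyFormulaZ2.Cruxes.NestingRigidity.PinchResampling

open MeasureTheory ProbabilityTheory
open scoped ENNReal ProbabilityTheory

section Bookkeeping

variable {S S' Ω : Type*} [MeasurableSpace S] [MeasurableSpace S'] [MeasurableSpace Ω]

/-- The value of a measure–kernel composition on a measurable set is the average of the fibre values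
(`Measure.bind_apply`). -/
theorem comp_apply_eq_lintegral (ν : Measure S) (κ : Kernel S Ω) {s : Set Ω} (hs : MeasurableSet s) :
    (κ ∘ₘ ν) s = ∫⁻ y, κ y s ∂ν :=
  Measure.bind_apply hs κ.aemeasurable

/-- A fibrewise bound on a bad event integrates to a bound for the glued measure. -/
theorem comp_apply_le_lintegral_of_ae_le (ν : Measure S) (κ : Kernel S Ω) {s : Set Ω} (hs : MeasurableSet s)
    {g : S → ℝ≥0∞} (h : ∀ᵐ y ∂ν, κ y s ≤ g y) : (κ ∘ₘ ν) s ≤ ∫⁻ y, g y ∂ν := by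
  rw [comp_apply_eq_lintegral ν κ hs]
  exact lintegral_mono_ae h

/-- Composing a measure on `S × S'` with a kernel reading only the FIRST coordinate is composing its first marginal
with that kernel. -/
theorem comp_prodMkRight_eq_comp_map_fst (ν : Measure (S × S')) (η : Kernel S Ω) :
    (Kernel.prodMkRight S' η) ∘ₘ ν = η ∘ₘ (ν.map Prod.fst) := by
  ext s hs
  rw [Measure.bind_apply hs (Kernel.aemeasurable _), Measure.bind_apply hs (Kernel.aemeasurable _),
    lintegral_map (Kernel.measurable_coe η hs) measurable_fst]
  simp [Kernel.prodMkRight_apply]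

/-- Composing a measure on `S × S'` with a kernel reading only the SECOND coordinate is composing its second marginal
with that kernel. -/
theorem comp_prodMkLeft_eq_comp_map_snd (ν : Measure (S × S')) (η : Kernel S' Ω) :
    (Kernel.prodMkLeft S η) ∘ₘ ν = η ∘ₘ (ν.map Prod.snd) := by
  ext s hs
  rw [Measure.bind_apply hs (Kernel.aemeasurable _), Measure.bind_apply hs (Kernel.aemeasurable _),
    lintegral_map (Kernel.measurable_coe η hs) measurable_snd]
  simp [Kernel.prodMkLeft_apply]

end Bookkeeping

section Disintegration

variable {Ω S : Type*} [MeasurableSpace Ω] [StandardBorelSpace Ω] [Nonempty Ω] [MeasurableSpace S]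

/-- **Disintegration along a statistic**: re-drawing `ω` from its conditional law given `Y = y`, with `y` drawn from
the law of `Y`, reproduces the law of `ω` — `(condDistrib id Y μ) ∘ₘ (μ.map Y) = μ` (Mathlib's `condDistrib_comp_map`
at the identity). -/
theorem condDistrib_id_comp_map (μ : Measure Ω) [IsFiniteMeasure μ] {Y : Ω → S} (hY : Measurable Y) :
    (condDistrib id Y μ) ∘ₘ (μ.map Y) = μ := by
  rw [condDistrib_comp_map hY.aemeasurable aemeasurable_id, Measure.map_id]

end Disintegration

section Recoupling

/-- **Re-coupling through conditional laws (registered anchor; brick B2 of stub S4).**  Let `P` be a coupling of the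
probability measures `μ` on `Ω` and `μ'` on `Ω'` (standard Borel), `Y : Ω → S` and `Y' : Ω' → S'` measurable
statistics, and `κ` a kernel from `S × S'` to `Ω × Ω'` such that for `Law_P(Y, Y')`-almost every `(y, y')` the
measure `κ (y, y')` has first marginal the conditional law of `ω` given `Y = y` under `μ` and second marginal the
conditional law of `ω'` given `Y' = y'` under `μ'`.  Then the glued measure `κ ∘ₘ Law_P(Y, Y')` — draw the retained
data jointly from the old coupling, then re-draw everything else fibrewise from the coupled conditional laws — is a
coupling of `μ` and `μ'`.  No structure (stopping set, Markov property) is required of `Y`, `Y'`. -/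
theorem map_fst_comp_eq_and_map_snd_comp_eq_of_condDistrib : ∀ {Ω Ω' S S' : Type*} [MeasurableSpace Ω] [StandardBorelSpace Ω] [Nonempty Ω] [MeasurableSpace Ω'] [StandardBorelSpace Ω'] [Nonempty Ω'] [MeasurableSpace S] [MeasurableSpace S'] (μ : Measure Ω) [IsProbabilityMeasure μ] (μ' : Measure Ω') [IsProbabilityMeasure μ'] (P : Measure (Ω × Ω')) (Y : Ω → S) (Y' : Ω' → S') (κ : Kernel (S × S') (Ω × Ω')), P.map Prod.fst = μ → P.map Prod.snd = μ' → Measurable Y → Measurable Y' → (∀ᵐ p ∂(P.map fun q ↦ (Y q.1, Y' q.2)), (κ p).map Prod.fst = condDistrib id Y μ p.1) → (∀ᵐ p ∂(P.map fun q ↦ (Y q.1, Y' q.2)), (κ p).map Prod.snd = condDistrib id Y' μ' p.2) → (κ ∘ₘ (P.map fun q ↦ (Y q.1, Y' q.2))).map Prod.fst = μ ∧ (κ ∘ₘ (P.map fun q ↦ (Y q.1, Y' q.2))).map Prod.snd = μ' := by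
  intro Ω Ω' S S' _ _ _ _ _ _ _ _ μ _ μ' _ P Y Y' κ h₁ h₂ hY hY' hκ₁ hκ₂
  have hYY' : Measurable fun q : Ω × Ω' ↦ (Y q.1, Y' q.2) := (hY.comp measurable_fst).prodMk (hY'.comp measurable_snd)
  set ν : Measure (S × S') := P.map fun q ↦ (Y q.1, Y' q.2) with hν
  -- the two marginals of `ν` are the laws of `Y` under `μ` and of `Y'` under `μ'`
  have hν₁ : ν.map Prod.fst = μ.map Y := by
    rw [hν, Measure.map_map measurable_fst hYY', ← h₁, Measure.map_map hY measurable_fst]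
    rfl
  have hν₂ : ν.map Prod.snd = μ'.map Y' := by
    rw [hν, Measure.map_map measurable_snd hYY', ← h₂, Measure.map_map hY' measurable_snd]
    rfl
  constructor
  · calc (κ ∘ₘ ν).map Prod.fst = (κ.map Prod.fst) ∘ₘ ν := Measure.map_comp ν κ measurable_fst
      _ = (Kernel.prodMkRight S' (condDistrib id Y μ)) ∘ₘ ν := by
          refine Measure.comp_congr ?_
          filter_upwards [hκ₁] with p hp
          rw [Kernel.map_apply _ measurable_fst, hp, Kernel.prodMkRight_apply]
      _ = (condDistrib id Y μ) ∘ₘ (ν.map Prod.fst) := comp_prodMkRight_eq_comp_map_fst ν _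
      _ = μ := by rw [hν₁, condDistrib_id_comp_map μ hY]
  · calc (κ ∘ₘ ν).map Prod.snd = (κ.map Prod.snd) ∘ₘ ν := Measure.map_comp ν κ measurable_snd
      _ = (Kernel.prodMkLeft S (condDistrib id Y' μ')) ∘ₘ ν := by
          refine Measure.comp_congr ?_
          filter_upwards [hκ₂] with p hp
          rw [Kernel.map_apply _ measurable_snd, hp, Kernel.prodMkLeft_apply]
      _ = (condDistrib id Y' μ') ∘ₘ (ν.map Prod.snd) := comp_prodMkLeft_eq_comp_map_snd ν _
      _ = μ' := by rw [hν₂, condDistrib_id_comp_map μ' hY']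

/-- **The bad event of the re-coupling.**  Under the hypotheses of
`map_fst_comp_eq_and_map_snd_comp_eq_of_condDistrib`, if the fibre couplings charge a measurable bad set `B` by at most
`g (y, y')` for `Law_P(Y, Y')`-a.e. `(y, y')`, the glued coupling charges `B` by at most `∫⁻ g dLaw_P(Y, Y')`
— in the transfer: (probability that the retained data are not good) + (average total-variation mismatch of the two
routing laws). -/
theorem comp_map_apply_le {Ω Ω' S S' : Type*} [MeasurableSpace Ω] [MeasurableSpace Ω'] [MeasurableSpace S]
    [MeasurableSpace S'] (P : Measure (Ω × Ω')) (Y : Ω → S) (Y' : Ω' → S') (κ : Kernel (S × S') (Ω × Ω'))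
    {B : Set (Ω × Ω')} (hB : MeasurableSet B) {g : S × S' → ℝ≥0∞}
    (h : ∀ᵐ p ∂(P.map fun q ↦ (Y q.1, Y' q.2)), κ p B ≤ g p) :
    (κ ∘ₘ (P.map fun q ↦ (Y q.1, Y' q.2))) B ≤ ∫⁻ p, g p ∂(P.map fun q ↦ (Y q.1, Y' q.2)) :=
  comp_apply_le_lintegral_of_ae_le _ κ hB h

end Recoupling

section Countable

variable {S S' Ω Ω' : Type*} [MeasurableSpace S] [MeasurableSpace S'] [MeasurableSpace Ω] [MeasurableSpace Ω']

/-- On a countable discrete data space every family of fibre measures is a kernel (measurability is automatic), so in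
the discrete setting of the transfer (finitely many coarse data values at fixed mesh) the fibre couplings may be chosen
pointwise, e.g. as maximal couplings of the two routing laws. -/
theorem exists_kernel_eq_of_countable [Countable (S × S')] [MeasurableSingletonClass (S × S')]
    (q : S × S' → Measure (Ω × Ω')) : ∃ κ : Kernel (S × S') (Ω × Ω'), ∀ p, κ p = q p :=
  ⟨Kernel.ofFunOfCountable q, fun _ ↦ rfl⟩

end Countable

end Summit.CriticalPhenomena.CardyFormulaZ2.Cruxes.NestingRigidity.PinchResampling

end
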